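import Literature.Topology.FourManifolds.ThreeTorusHomologyTwo
import Literature.Topology.FourManifolds.GluckTwistFreedmanSmooth
import HarnessLib

/-!
# Cappell–Shaneson spheres are homeomorphic to `S⁴`: the fact over its four remaining leaves
# (Cappell–Shaneson 1976, §2 + Freedman 1982, Thm. 1.6) — proved glue, no new named fact

Fact seat `provefact-Literature.Topology.FourManifolds.nonemp-66214ed237` (D-0014/D-0026) for the
named fact `Literature.Topology.FourManifolds.nonempty_homeomorph_sphere_four_of_isCappellShanesonSphere`
(`CappellShaneson.lean`): *every Cappell–Shaneson sphere `X` — the closed 4-manifold obtained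
from the mapping torus of the linear diffeomorphism of `T³` given by `A ∈ SL(3, ℤ)`,
`det (A - 1) = ±1`, by surgery on the section circle through the fixed point, either framing
(`IsCappellShanesonSphere X`) — is homeomorphic to `S⁴`*.

## The source line (approach A of the seat) and the statement check

The printed argument has two steps and no others:

1. (S. E. Cappell, J. L. Shaneson, *Some new four-manifolds*, Ann. of Math. 104 (1976), §2;
   restated verbatim in R. Gompf, *More Cappell–Shaneson spheres are standard*, Algebr. Geom.
   Topol. 10 (2010), §2, first paragraph (p. 3 of arXiv:0908.1914v2): "The
   Cappell-Shaneson examples arise when `M` is the 3-torus, so `φ` is obtained from some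
   `A ∈ SL(3, ℤ)`, and `X^ε_φ` is a homotopy 4-sphere if and only if `det(A − I) = ±1`", both
   framings `ε = 0, 1`, cf. §3, first paragraph) the surgered mapping torus is a **homotopy
   4-sphere** — the tree's named fact
   `Literature.Topology.FourManifolds.nonempty_homotopyEquiv_sphere_four_of_isCappellShanesonSphere`;
2. (M. H. Freedman, *The topology of four-dimensional manifolds*, J. Differential Geom. 17 (1982),
   Thm. 1.6, p. 371: "If `Σ⁴` is a topological 4-manifold homotopy equivalent to the 4-sphere
   `S⁴`, then `Σ⁴` is homeomorphic to `S⁴`"; Freedman–Quinn (1990), Cor. 7.1B) hence it is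
   **homeomorphic to `S⁴`** — the tree's named fact
   `Literature.Topology.FourManifolds.nonempty_homeomorph_sphere_four` (`spc4.S04`).

The fact is stated with the binders `(X : Type u) [TopologicalSpace X] [ChartedSpace (𝔼 4) X]`
only (Hausdorffness, second countability, compactness are consequences of
`IsCappellShanesonSphere X`, proved in `CappellShanesonHomotopySphere.lean`), for every
`A` with `det (A - 1) = 1` **or** `-1` and for **both** framings; steps 1–2 cover exactly this
generality (the homotopy type does not depend on the framing; `det (A⁻¹ - 1) = -det (A - 1)`).
Not mis-stated.

## Triage: SIZE XL, and what the tree already holds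

Both steps are theories of their own, and both have been decomposed in the tree down to general
textbook theorems, with every Cappell–Shaneson-, torus-, surgery- and puncture-specific input
PROVED:

* step 1 ⇐ Poincaré duality (Hatcher Thm. 3.30, `bijective_poincareDualityMap`, used for `T³`
  in degrees `(1, 2)` and for closed 4-manifolds in degrees `(1, 3)`) + Whitehead's theorem
  (Cor. 4.33, `whitehead_exists_homotopyEquiv`) + CW homotopy type of compact manifolds
  (Cor. A.12, `exists_cwComplex_homotopyEquiv_of_compactSpace`):
  `nonempty_homotopyEquiv_sphere_four_of_isCappellShanesonSphere_of_textbookFacts`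
  (`ThreeTorusHomologyTwo.lean`, through `CappellShanesonWang(Proofs)`, `CappellShanesonProofs`,
  `ThreeTorusOrientation`, `ThreeTorusHomologyOne`, `HomotopyS4Criterion`);
* step 2 ⇐ Freedman's `ℝ⁴` recognition theorem Cor. 1.2 (`HomotopyS4Freedman.lean`), and — since
  a Cappell–Shaneson sphere is homeomorphic to a *smooth* closed model in `Type`
  (`IsCappellShanesonSphereOf.exists_nonempty_homeomorph_universe_zero`) — alternatively
  ⇐ Cor. 1.2 for smooth `V` only (`Freedman1982_nonempty_homeomorph_euclideanSpace_four_of_isManifold`,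
  `GluckTwistFreedmanSmooth.lean`), or ⇐ `Θ₄ = 0` + Freedman's compact h-cobordism theorem
  Thm. 1.3 (`HomotopyS4SmoothCase.lean`).

This file only closes the bracket: it records the target fact as a PROVED consequence of exactly
the remaining named-fact leaves, in the three available forms of step 2, and the (trivial)
converse direction showing that the target is the strongest of the three sibling facts of
`CappellShaneson.lean`. The unconditional `…_holds` is NOT claimed: it is precisely as far away as
proofs of Hatcher Thm. 3.30 / Cor. 4.33 / Cor. A.12 and of Freedman's Cor. 1.2 (Casson handles,
Bing shrinking, the proper h-cobordism theorem Thm. 10.3), each of which has its own fact seat.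

## Main statements (all proved; no definition, no named fact, no instance)

* `nonempty_homeomorph_sphere_four_of_isCappellShanesonSphere_of_textbookFacts_of_freedman1982_smooth`
  — the target, every universe, from {Thm. 3.30, Cor. 4.33, Cor. A.12, smooth Cor. 1.2};
* `…_of_textbookFacts_of_thetaFour` — from {Thm. 3.30, Cor. 4.33, Cor. A.12, `Θ₄ = 0`, Thm. 1.3};
* `…_of_textbookFacts_of_freedman` — from {Thm. 3.30, Cor. 4.33, Cor. A.12, Thm. 1.6};
* `nonempty_homotopyEquiv_sphere_four_of_isCappellShanesonSphere_of_homeomorph` — the target fact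
  implies its sibling homotopy-sphere fact (a homeomorphism is a homotopy equivalence); the third
  sibling, `simplyConnectedSpace_of_isCappellShanesonSphere`, is a theorem of the tree outright
  (`simplyConnectedSpace_of_isCappellShanesonSphere_holds`, `CappellShanesonProofs.lean`), so no
  conditional form of it is recorded here;
* `nonempty_homeomorph_iff_nonempty_homotopyEquiv_of_isCappellShanesonSphere_of_freedman` — over
  Thm. 1.6 the target fact and the homotopy-sphere fact are equivalent (universe `0`).

## References

* S. E. Cappell, J. L. Shaneson, *Some new four-manifolds*, Ann. of Math. 104 (1976) 61–72, §2
  [CappellShanesonAnnals1976] (not held; statement of §2 read in Gompf 2010, §§2–3).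
* R. E. Gompf, *More Cappell–Shaneson spheres are standard*, Algebr. Geom. Topol. 10 (2010)
  1665–1681, §2 first paragraph, §3 first paragraph [GompfAGT2010].
* M. H. Freedman, *The topology of four-dimensional manifolds*, J. Differential Geom. 17 (1982)
  357–453, Thm. 1.6 (p. 371), Cor. 1.2 (p. 366), Thm. 1.3 (p. 363) [FreedmanJDG1982].
* M. H. Freedman, F. Quinn, *Topology of 4-manifolds* (1990), Cor. 7.1B [FreedmanQuinnPMS1990].
* A. Hatcher, *Algebraic Topology* (2002), Thm. 3.30, Cor. 4.33, Cor. A.12, Prop. 1.14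
  [HatcherAT2002].
-/

noncomputable section

open Set Function ContinuousMap CategoryTheory
open Literature.AlgebraicTopology.SingularHomology Literature.AlgebraicTopology.Homotopy
open scoped Manifold ContDiff

namespace Literature.Topology.FourManifolds

universe u

/-! ### §1 The target fact over its remaining leaves -/

/-- **Cappell–Shaneson spheres are homeomorphic to `S⁴`, from Poincaré duality, Whitehead's
theorem, the CW homotopy type of compact manifolds, and Freedman's Cor. 1.2 for smooth `V`**
(every universe). Step 1 (Cappell–Shaneson 1976, §2: homotopy 4-sphere) is
`nonempty_homotopyEquiv_sphere_four_of_isCappellShanesonSphere_of_textbookFacts` over `hPD`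
(Hatcher Thm. 3.30), `hW` (Cor. 4.33), `hCW` (Cor. A.12); step 2 (Freedman 1982, Thm. 1.6, in the
smooth case, which suffices because a Cappell–Shaneson sphere is homeomorphic to a closed smooth
model in `Type`) is `nonempty_homeomorph_sphere_four_of_isCappellShanesonSphere_of_freedman1982_smooth`
over `hF` (Cor. 1.2, p. 366, for smooth `V`). This is the finest form of the seat's residual claim:
`…_holds` would be this theorem applied to proofs of the four hypotheses.
[cite: CappellShanesonAnnals1976, §2] [cite: FreedmanJDG1982, Thm. 1.6 p. 371 and Cor. 1.2 p. 366] -/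
theorem nonempty_homeomorph_sphere_four_of_isCappellShanesonSphere_of_textbookFacts_of_freedman1982_smooth
    (hPD : ∀ (M : Type) [TopologicalSpace M] [CompactSpace M] [T2Space M] (n : ℕ)
      [ChartedSpace (EuclideanSpace ℝ (Fin n)) M] (μ : HomologicalOrientation ℤ M n) (p q : ℕ) (h : p + q = n),
      bijective_poincareDualityMap μ h)
    (hW : whitehead_exists_homotopyEquiv.{0})
    (hCW : exists_cwComplex_homotopyEquiv_of_compactSpace.{0})
    (hF : Freedman1982_nonempty_homeomorph_euclideanSpace_four_of_isManifold.{0})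
    (X : Type u) [TopologicalSpace X] [ChartedSpace (EuclideanSpace ℝ (Fin 4)) X] :
    nonempty_homeomorph_sphere_four_of_isCappellShanesonSphere X :=
  nonempty_homeomorph_sphere_four_of_isCappellShanesonSphere_of_freedman1982_smooth
    (fun Y _ _ ↦
      nonempty_homotopyEquiv_sphere_four_of_isCappellShanesonSphere_of_textbookFacts hPD hW hCW Y)
    hF X

/-- **The same over `Θ₄ = 0` and Freedman's compact h-cobordism theorem** (every universe):
step 2 through `isHCobordant_sphere_of_homotopySphere_four` (Kervaire–Milnor 1963, Thm. 1.1 /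
Wall 1964: every smooth homotopy 4-sphere is h-cobordant to `S⁴`) and
`nonempty_homeomorph_of_isHCobordant_four.{0}` (Freedman 1982, Thm. 1.3, p. 363: simply connected
compact smooth 5-dimensional h-cobordisms are topological products), via
`nonempty_homeomorph_sphere_four_of_isCappellShanesonSphere_of_thetaFour`.
[cite: CappellShanesonAnnals1976, §2] [cite: FreedmanJDG1982, Thm. 1.3 p. 363 with Thm. 1.6 p. 371] -/
theorem nonempty_homeomorph_sphere_four_of_isCappellShanesonSphere_of_textbookFacts_of_thetaFour
    (hPD : ∀ (M : Type) [TopologicalSpace M] [CompactSpace M] [T2Space M] (n : ℕ)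
      [ChartedSpace (EuclideanSpace ℝ (Fin n)) M] (μ : HomologicalOrientation ℤ M n) (p q : ℕ) (h : p + q = n),
      bijective_poincareDualityMap μ h)
    (hW : whitehead_exists_homotopyEquiv.{0})
    (hCW : exists_cwComplex_homotopyEquiv_of_compactSpace.{0})
    (hΘ : isHCobordant_sphere_of_homotopySphere_four)
    (h13 : nonempty_homeomorph_of_isHCobordant_four.{0})
    (X : Type u) [TopologicalSpace X] [ChartedSpace (EuclideanSpace ℝ (Fin 4)) X] :
    nonempty_homeomorph_sphere_four_of_isCappellShanesonSphere X :=
  nonempty_homeomorph_sphere_four_of_isCappellShanesonSphere_of_thetaFour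
    (fun Y _ _ ↦
      nonempty_homotopyEquiv_sphere_four_of_isCappellShanesonSphere_of_textbookFacts hPD hW hCW Y)
    hΘ h13 X

/-- **The same over Freedman's Thm. 1.6 for all topological 4-manifolds** (every universe): the
printed two-step argument itself — step 1 from the three textbook facts, step 2 the named fact
`nonempty_homeomorph_sphere_four.{0}` (Freedman 1982, Thm. 1.6; Freedman–Quinn 1990, Cor. 7.1B),
via `nonempty_homeomorph_sphere_four_of_isCappellShanesonSphere_of`.
[cite: CappellShanesonAnnals1976, §2] [cite: FreedmanJDG1982, Thm. 1.6 p. 371] -/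
theorem nonempty_homeomorph_sphere_four_of_isCappellShanesonSphere_of_textbookFacts_of_freedman
    (hPD : ∀ (M : Type) [TopologicalSpace M] [CompactSpace M] [T2Space M] (n : ℕ)
      [ChartedSpace (EuclideanSpace ℝ (Fin n)) M] (μ : HomologicalOrientation ℤ M n) (p q : ℕ) (h : p + q = n),
      bijective_poincareDualityMap μ h)
    (hW : whitehead_exists_homotopyEquiv.{0})
    (hCW : exists_cwComplex_homotopyEquiv_of_compactSpace.{0})
    (hF : FourManifolds.nonempty_homeomorph_sphere_four.{0})
    (X : Type u) [TopologicalSpace X] [ChartedSpace (EuclideanSpace ℝ (Fin 4)) X] :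
    nonempty_homeomorph_sphere_four_of_isCappellShanesonSphere X :=
  nonempty_homeomorph_sphere_four_of_isCappellShanesonSphere_of
    (fun Y _ _ ↦
      nonempty_homotopyEquiv_sphere_four_of_isCappellShanesonSphere_of_textbookFacts hPD hW hCW Y)
    hF X

/-! ### §2 The target fact is the strongest of the three sibling facts -/

/-- **Homeomorphic to `S⁴` ⟹ homotopy equivalent to `S⁴`**: the target fact (at universe `u`)
implies the homotopy-sphere fact `nonempty_homotopyEquiv_sphere_four_of_isCappellShanesonSphere`
(Cappell–Shaneson 1976, §2) at the same universe — a homeomorphism is a homotopy equivalence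
(`Homeomorph.toHomotopyEquiv`). [cite: CappellShanesonAnnals1976, §2] -/
theorem nonempty_homotopyEquiv_sphere_four_of_isCappellShanesonSphere_of_homeomorph
    (h : ∀ (Y : Type u) [TopologicalSpace Y] [ChartedSpace (EuclideanSpace ℝ (Fin 4)) Y],
      nonempty_homeomorph_sphere_four_of_isCappellShanesonSphere Y)
    (X : Type u) [TopologicalSpace X] [ChartedSpace (EuclideanSpace ℝ (Fin 4)) X] :
    nonempty_homotopyEquiv_sphere_four_of_isCappellShanesonSphere X := by
  intro hX
  obtain ⟨e⟩ := h X hX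
  exact ⟨e.toHomotopyEquiv⟩

/-- **Over Freedman's Thm. 1.6 the target fact and the homotopy-sphere fact are equivalent**
(universe `0`, where the models live; both lift to every universe by
`nonempty_homeomorph_sphere_four_of_isCappellShanesonSphere_of_universe_zero` and
`nonempty_homotopyEquiv_sphere_four_of_isCappellShanesonSphere_of_universe_zero`): "homotopy
4-sphere" (Cappell–Shaneson 1976) and "homeomorphic to `S⁴`" say the same thing about a
Cappell–Shaneson sphere once Thm. 1.6 is granted. [cite: FreedmanJDG1982, Thm. 1.6 p. 371] -/
theorem nonempty_homeomorph_iff_nonempty_homotopyEquiv_of_isCappellShanesonSphere_of_freedman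
    (hF : FourManifolds.nonempty_homeomorph_sphere_four.{0}) :
    (∀ (Y : Type) [TopologicalSpace Y] [ChartedSpace (EuclideanSpace ℝ (Fin 4)) Y],
        nonempty_homeomorph_sphere_four_of_isCappellShanesonSphere Y) ↔
      ∀ (Y : Type) [TopologicalSpace Y] [ChartedSpace (EuclideanSpace ℝ (Fin 4)) Y],
        nonempty_homotopyEquiv_sphere_four_of_isCappellShanesonSphere Y :=
  ⟨fun h Y _ _ ↦ nonempty_homotopyEquiv_sphere_four_of_isCappellShanesonSphere_of_homeomorph h Y,
    fun h Y _ _ ↦ nonempty_homeomorph_sphere_four_of_isCappellShanesonSphere_of h hF Y⟩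

end Literature.Topology.FourManifolds

end
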